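import Literature.NumberTheory.EllipticCurves.CanonicalPAdicHeightThetaLogDerivProofs
import Literature.NumberTheory.EllipticCurves.PadicSigmaUniquenessProofs
import HarnessLib

/-!
# The Mazur–Tate theta relation as a formal identity: discharge of `padicSigma_theta_formal`
# (Blakestad–Grant 2023, Prop. 14 — proofs only)

Trunk T-NT-EC (Literature/NumberTheory/EllipticCurves). Final proof file behind the named fact
`WeierstrassCurve.padicSigma_theta_formal` (`CanonicalPAdicHeightThetaProofs.lean`): for `W/ℚ`
globally minimal, `p ≥ 5` good ordinary and ANY Mazur–Tate pair `(σ, c)` of `W ⊗ ℚ_p`,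
`σ(F(u,v)) σ(F(u,i(v))) u²v² = (u²X(v) - v²X(u)) σ(u)² σ(v)²` in `ℚ_p⟦u, v⟧` — the theta relation
`σ(u +_F v)σ(u -_F v)/(σ(u)²σ(v)²) = x(v) - x(u)` with poles cleared. The proof is
Blakestad–Grant's (Prop. 14), formalised over the chord–tangent formal group of the tree:

* Step A (`CanonicalPAdicHeightThetaLogDerivProofs.lean`): both sides have the same second
  logarithmic `u`-derivative along the invariant derivation `D₁ = d/ω` — the sigma equation at
  `u ±_F v` through the invariance of `D₁` (`SigmaODELogDerivProofs.lean`), the `x`-calculus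
  (`FormalGroupXDerivativeProofs.lean`) and the addition formula for `x` = their Lemma 10
  (`FormalGroupLawAddXProofs.lean`, by the identity theorem from the group law at points);
* `logDeriv₂Num_thetaLHS_mul_sq_eq` — Step A concluded: **`N(L)·R² = N(R)·L²`** from the ratio
  data and `n_L·d_R = n_R·d_L` of `CanonicalPAdicHeightThetaLogDerivProofs.lean` (cancel the
  non-zero `F²Fm²u²·ε²X(u)²u²` in the domain `ℚ_p⟦u, v⟧`);
* `eq_of_logDeriv₂Num_X_sq_mul_eq` — **Steps B–C, abstractly**: if `u²L̃`, `u²R̃` have the same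
  second logarithmic `D₁`-derivative, `L̃(0,v) = R̃(0,v) = m ≠ 0` and `∂ᵤL̃(0,v) = ∂ᵤR̃(0,v) = 0`,
  then `L̃ = R̃`: the Wronskian `w = L̃∂ᵤR̃ - R̃∂ᵤL̃` satisfies `∂ᵤ(ηw)·L̃R̃ = ηw·∂ᵤ(L̃R̃)`
  (`deriv_wronskian_mul_eq`, after cancelling `η(u)u⁸`), so `ηw = 0` and then `L̃ = R̃` by the
  Wronskian lemma of `MvPowerSeriesLogDerivWronskianProofs.lean` ("the first logarithmic
  derivatives … differ additively by `μ(t₂)` … `μ(t₂) = 0` … the ratio … is `ν(t₂)` … `ν(t₂) = 1`";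
  here the two constants are fixed by the expansions at `u = 0`,
  `SigmaThetaLeadingCoeffProofs.lean`, instead of by parity);
* `thetaLHS_eq_thetaRHS` — the theta relation for every normalised odd solution `σ` of the sigma
  equation of an elliptic curve over `ℚ_p` with `p`-integral equation;
* `padicSigma_theta_formal_holds` — **discharge of the named fact**.

With `formalGroupLaw_padicEval_holds` (θ₃) this leaves `exists_isCanonical` resting on the
single named fact `mazur_tate_sigma_existsUnique` (MST 2006 Thm. 1.3, existence half).

## Sources

* C. Blakestad, D. Grant, *On the universal `p`-adic sigma and Weierstrass zeta functions*,
  J. Number Theory 249 (2023) (arXiv:1903.02480), §3: Lemma 10, Prop. 14 and its proof.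
* B. Mazur, J. Tate, *The `p`-adic sigma function*, Duke Math. J. 62 (1991), Thm. 3.1 (the theta
  relation characterises `σ`).
* B. Mazur, W. Stein, J. Tate, Doc. Math. Extra Vol. Coates (2006), Thm. 1.3, §2.7.

## Design notes

Pure proof file; no definitions, no new named facts. `padicSigma_theta_formal_holds` has exactly
the type `padicSigma_theta_formal`.
-/

noncomputable section

open scoped Classical
open PowerSeries Literature.NumberTheory.EllipticCurves
open Literature.AlgebraicGeometry.Resolution (MvPowerSeries.pderiv MvPowerSeries.pderiv_X
  MvPowerSeries.pderiv_powerSeries_subst_X)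

namespace WeierstrassCurve

/-! ### Step A concluded: `N(L)·R² = N(R)·L²` -/

section StepA

variable {p : ℕ} [Fact p.Prime] (V : WeierstrassCurve ℚ_[p]) [hV : V.IsIntegral ℤ_[p]] [V.IsElliptic]
  {σ : ℚ_[p]⟦X⟧} {c : ℚ_[p]}

/-- **Step A of Blakestad–Grant's proof: `N(L)·R² = N(R)·L²`** — the two pole-cleared sides of
the theta relation have the same second logarithmic `u`-derivative along `D₁ = d/ω`.
[Blakestad–Grant 2023, proof of Prop. 14] [folklore] -/
theorem logDeriv₂Num_thetaLHS_mul_sq_eq (hσ0 : constantCoeff σ = 0) (hσ1 : coeff 1 σ = 1)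
    (hODE : V.SatisfiesSigmaODE σ c) :
    logDeriv₂Num (V.formalInvariantDerivationMv 0) (V.thetaLHS σ) * V.thetaRHS σ ^ 2 =
      logDeriv₂Num (V.formalInvariantDerivationMv 0) (V.thetaRHS σ) * V.thetaLHS σ ^ 2 := by
  have hL := V.logDeriv₂Num_thetaLHS_ratio hσ0 hσ1 hODE
  have hR := V.logDeriv₂Num_thetaRHS_ratio hσ0 hσ1 hODE
  have hS := V.thetaLHS_ratio_mul_eq (c := c)
  obtain ⟨hXu0, -, hε0, hF0, hFm0, -⟩ := V.stepA_factors_ne_zero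
  have hu0 := mvPowerSeries_X_ne_zero (p := p) 0
  set D₁ := V.formalInvariantDerivationMv (0 : Fin 2)
  set u := (MvPowerSeries.X 0 : MvPowerSeries (Fin 2) ℚ_[p])
  set v := (MvPowerSeries.X 1 : MvPowerSeries (Fin 2) ℚ_[p])
  set F := V.formalGroupLaw
  set Fm := V.formalGroupLawSub
  set Xu := V.formalXMulSq.subst u
  set ε := (X ^ 2 * V.formalWDivCube).subst u - (X ^ 2 * V.formalWDivCube).subst v
  set L := V.thetaLHS σ
  set Rt := V.thetaRHS σ
  have hd : (F ^ 2 * Fm ^ 2 * u ^ 2) * (ε ^ 2 * Xu ^ 2 * u ^ 2) ≠ 0 :=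
    mul_ne_zero (mul_ne_zero (mul_ne_zero (pow_ne_zero 2 hF0) (pow_ne_zero 2 hFm0)) (pow_ne_zero 2 hu0))
      (mul_ne_zero (mul_ne_zero (pow_ne_zero 2 hε0) (pow_ne_zero 2 hXu0)) (pow_ne_zero 2 hu0))
  refine mul_right_cancel₀ hd ?_
  linear_combination (Rt ^ 2 * (ε ^ 2 * Xu ^ 2 * u ^ 2)) * hL - (L ^ 2 * (F ^ 2 * Fm ^ 2 * u ^ 2)) * hR +
    (L ^ 2 * Rt ^ 2) * hS

end StepA

/-! ### Steps B–C: from equal second logarithmic derivatives to equality -/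

section StepBC

variable {R : Type*} [CommRing R] (W : WeierstrassCurve R)

/-- `Xᵢ ≠ 0` in `R⟦u, v⟧`. [folklore] -/
theorem mvX_ne_zero [Nontrivial R] (i : Fin 2) : (MvPowerSeries.X i : MvPowerSeries (Fin 2) R) ≠ 0 := by
  intro h
  have := congrArg (MvPowerSeries.coeff (Finsupp.single i 1)) h
  rw [MvPowerSeries.coeff_X, if_pos rfl, map_zero] at this
  exact one_ne_zero this

variable [IsDomain R] [CharZero R]

variable {W} in
/-- **Steps B–C of Blakestad–Grant's proof, abstractly.** Let `D₁ = η(u)∂ᵤ` and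
`N(f) = f·D₁²f - (D₁f)²`. If `N(u²L̃)·(u²R̃)² = N(u²R̃)·(u²L̃)²` (equal second logarithmic
derivatives), `L̃(0, v) = R̃(0, v) = m ≠ 0` and `∂ᵤL̃(0, v) = ∂ᵤR̃(0, v) = 0`, then `L̃ = R̃`:
the Wronskian relation `deriv_wronskian_mul_eq` descends to `w = L̃∂ᵤR̃ - R̃∂ᵤL̃` after cancelling
`η(u)·u⁸`; `ηw` vanishes at `u = 0`, so `ηw = 0` (`eq_zero_of_pderiv_mul_eq`); then
`∂ᵤL̃·R̃ = L̃·∂ᵤR̃` and `L̃(0,v) = R̃(0,v)` give `L̃ = R̃` (`eq_of_pderiv_mul_eq_of_subst_zero_ne_zero`).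
[Blakestad–Grant 2023, proof of Prop. 14 ("differ additively by a function `μ(t₂)` …
`μ(t₂) = 0` … the ratio of both sides … is a function `ν(t₂)` … `ν(t₂) = 1`")] [folklore] -/
theorem eq_of_logDeriv₂Num_X_sq_mul_eq {Lt Rt : MvPowerSeries (Fin 2) R} {m : R⟦X⟧}
    (hA : logDeriv₂Num (W.formalInvariantDerivationMv 0)
          ((MvPowerSeries.X 0 : MvPowerSeries (Fin 2) R) ^ 2 * Lt) *
          ((MvPowerSeries.X 0 : MvPowerSeries (Fin 2) R) ^ 2 * Rt) ^ 2 =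
        logDeriv₂Num (W.formalInvariantDerivationMv 0)
          ((MvPowerSeries.X 0 : MvPowerSeries (Fin 2) R) ^ 2 * Rt) *
          ((MvPowerSeries.X 0 : MvPowerSeries (Fin 2) R) ^ 2 * Lt) ^ 2)
    (hm : m ≠ 0) (hL0 : MvPowerSeries.subst ![(0 : R⟦X⟧), PowerSeries.X] Lt = m)
    (hR0 : MvPowerSeries.subst ![(0 : R⟦X⟧), PowerSeries.X] Rt = m)
    (hdL : MvPowerSeries.subst ![(0 : R⟦X⟧), PowerSeries.X] (MvPowerSeries.pderiv 0 Lt) = 0)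
    (hdR : MvPowerSeries.subst ![(0 : R⟦X⟧), PowerSeries.X] (MvPowerSeries.pderiv 0 Rt) = 0) :
    Lt = Rt := by
  have hs := hasSubst_zero_X (R := R)
  have hpu : MvPowerSeries.pderiv 0 (MvPowerSeries.X 0 : MvPowerSeries (Fin 2) R) = 1 := by
    rw [MvPowerSeries.pderiv_X, if_pos rfl]
  -- `η(u) ≠ 0`, `u ≠ 0`
  have he0 : W.formalEta.subst (MvPowerSeries.X 0 : MvPowerSeries (Fin 2) R) ≠ 0 := by
    refine fun h => one_ne_zero (α := R⟦X⟧) ?_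
    have := congrArg (MvPowerSeries.subst ![(0 : R⟦X⟧), PowerSeries.X]) h
    rwa [subst_zero_X_powerSeries_subst_X_zero, W.constantCoeff_formalEta, map_one,
      ← MvPowerSeries.coe_substAlgHom hs, map_zero] at this
  have hu0 := mvX_ne_zero (R := R) 0
  -- Step B: the Wronskian relation for `ηw`, `w = L̃∂R̃ - R̃∂L̃`, against `L̃R̃`
  have hw := deriv_wronskian_mul_eq (W.formalInvariantDerivationMv 0) hA
  have key : W.formalEta.subst (MvPowerSeries.X 0 : MvPowerSeries (Fin 2) R) *
      (MvPowerSeries.X 0 : MvPowerSeries (Fin 2) R) ^ 8 *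
      (MvPowerSeries.pderiv 0 (W.formalEta.subst (MvPowerSeries.X 0 : MvPowerSeries (Fin 2) R) *
            (Lt * MvPowerSeries.pderiv 0 Rt - Rt * MvPowerSeries.pderiv 0 Lt)) * (Lt * Rt) -
        W.formalEta.subst (MvPowerSeries.X 0 : MvPowerSeries (Fin 2) R) *
            (Lt * MvPowerSeries.pderiv 0 Rt - Rt * MvPowerSeries.pderiv 0 Lt) *
          MvPowerSeries.pderiv 0 (Lt * Rt)) = 0 := by
    simp only [formalInvariantDerivationMv_apply, Derivation.leibniz, Derivation.leibniz_pow, map_sub,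
      map_add, smul_eq_mul, nsmul_eq_mul, Nat.cast_ofNat, Nat.add_one_sub_one, pow_one, hpu, mul_one]
      at hw ⊢
    linear_combination hw
  have hW : MvPowerSeries.pderiv 0 (W.formalEta.subst (MvPowerSeries.X 0 : MvPowerSeries (Fin 2) R) *
          (Lt * MvPowerSeries.pderiv 0 Rt - Rt * MvPowerSeries.pderiv 0 Lt)) * (Lt * Rt) =
      W.formalEta.subst (MvPowerSeries.X 0 : MvPowerSeries (Fin 2) R) *
          (Lt * MvPowerSeries.pderiv 0 Rt - Rt * MvPowerSeries.pderiv 0 Lt) *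
        MvPowerSeries.pderiv 0 (Lt * Rt) := by
    rw [← sub_eq_zero]
    exact (mul_eq_zero.mp key).resolve_left (mul_ne_zero he0 (pow_ne_zero 8 hu0))
  -- Step C1: `ηw` vanishes at `u = 0`, hence is `0`
  have hg0 : MvPowerSeries.subst ![(0 : R⟦X⟧), PowerSeries.X] (Lt * Rt) ≠ 0 := by
    rw [MvPowerSeries.subst_mul hs, hL0, hR0]; exact mul_ne_zero hm hm
  have hh : W.formalEta.subst (MvPowerSeries.X 0 : MvPowerSeries (Fin 2) R) *
      (Lt * MvPowerSeries.pderiv 0 Rt - Rt * MvPowerSeries.pderiv 0 Lt) = 0 := by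
    refine eq_zero_of_pderiv_mul_eq hW ?_ hg0
    rw [MvPowerSeries.subst_mul hs, MvPowerSeries.subst_sub hs, MvPowerSeries.subst_mul hs,
      MvPowerSeries.subst_mul hs, hdL, hdR, mul_zero, mul_zero, sub_self, mul_zero]
  have hw0 : MvPowerSeries.pderiv 0 Lt * Rt = Lt * MvPowerSeries.pderiv 0 Rt := by
    have := (mul_eq_zero.mp hh).resolve_left he0
    linear_combination -this
  -- Step C2: the ratio is a function of `v`, equal to `1` at `u = 0`
  have hprop := eq_of_pderiv_mul_eq_of_subst_zero_ne_zero hw0 (by rw [hR0]; exact hm)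
  rw [hR0, hL0] at hprop
  have hιm : PowerSeries.subst (MvPowerSeries.X 1 : MvPowerSeries (Fin 2) R) m ≠ 0 := by
    intro h
    have := congrArg (MvPowerSeries.subst ![(0 : R⟦X⟧), PowerSeries.X]) h
    rw [subst_zero_X_powerSeries_subst_X_one, ← MvPowerSeries.coe_substAlgHom hs, map_zero] at this
    exact hm this
  exact mul_left_cancel₀ hιm hprop

end StepBC

/-! ### The theta relation for a normalised odd solution of the sigma equation -/

section Theta

variable {p : ℕ} [Fact p.Prime] (V : WeierstrassCurve ℚ_[p]) [hV : V.IsIntegral ℤ_[p]] [V.IsElliptic]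

variable {V} in
/-- **The formal theta relation** (Blakestad–Grant 2023, Prop. 14, for the chord–tangent formal
group of an elliptic curve over `ℚ_p` with `p`-integral equation): if `σ = t + ⋯` is odd
(`σ(i(t)) = -σ(t)`) and satisfies the sigma equation `x + c = -D(Dσ/σ)` (`SatisfiesSigmaODE`),
then `σ(u +_F v)σ(u -_F v)u²v² = (u²X(v) - v²X(u))σ(u)²σ(v)²` in `ℚ_p⟦u, v⟧`
(`thetaLHS σ = thetaRHS σ`), i.e. `σ(u +_F v)σ(u -_F v)/(σ(u)²σ(v)²) = x(v) - x(u)`.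
[Blakestad–Grant 2023, Prop. 14; Mazur–Tate 1991, Thm. 3.1] [cite: BlakestadGrant2023, Prop. 14] -/
theorem thetaLHS_eq_thetaRHS {σ : ℚ_[p]⟦X⟧} {c : ℚ_[p]} (hσ0 : constantCoeff σ = 0)
    (hσ1 : coeff 1 σ = 1) (hodd : V.IsFormallyOdd σ) (hODE : V.SatisfiesSigmaODE σ c) :
    V.thetaLHS σ = V.thetaRHS σ := by
  have hA := V.logDeriv₂Num_thetaLHS_mul_sq_eq hσ0 hσ1 hODE
  -- `σ = t·s`, `s(0) = 1`, `2s'(0) = a₁`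
  set s : ℚ_[p]⟦X⟧ := PowerSeries.mk fun n => coeff (n + 1) σ with hs
  have hσ : σ = X * s := by
    ext n
    cases n with
    | zero => rw [coeff_zero_X_mul, coeff_zero_eq_constantCoeff_apply, hσ0]
    | succ n => rw [coeff_succ_X_mul, hs, coeff_mk]
  have hs0 : constantCoeff s = 1 := by
    rw [← coeff_zero_eq_constantCoeff_apply, hs, coeff_mk]; exact hσ1
  have hs1 : 2 * coeff 1 s = V.a₁ := by
    rw [hs, coeff_mk]; exact V.two_mul_coeff_two_of_isFormallyOdd hodd hσ0 hσ1
  have hσu : σ.subst (MvPowerSeries.X 0 : MvPowerSeries (Fin 2) ℚ_[p]) =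
      (MvPowerSeries.X 0 : MvPowerSeries (Fin 2) ℚ_[p]) *
        s.subst (MvPowerSeries.X 0 : MvPowerSeries (Fin 2) ℚ_[p]) := by
    conv_lhs => rw [hσ]
    rw [PowerSeries.subst_mul (PowerSeries.HasSubst.X 0), PowerSeries.subst_X (PowerSeries.HasSubst.X 0)]
  -- the two sides as `u²·L̃`, `u²·R̃`
  set Lt := σ.subst V.formalGroupLaw * σ.subst V.formalGroupLawSub *
    (MvPowerSeries.X 1 : MvPowerSeries (Fin 2) ℚ_[p]) ^ 2 with hLt
  set Rt := ((MvPowerSeries.X 0 : MvPowerSeries (Fin 2) ℚ_[p]) ^ 2 *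
        V.formalXMulSq.subst (MvPowerSeries.X 1 : MvPowerSeries (Fin 2) ℚ_[p]) -
      (MvPowerSeries.X 1 : MvPowerSeries (Fin 2) ℚ_[p]) ^ 2 *
        V.formalXMulSq.subst (MvPowerSeries.X 0 : MvPowerSeries (Fin 2) ℚ_[p])) *
      s.subst (MvPowerSeries.X 0 : MvPowerSeries (Fin 2) ℚ_[p]) ^ 2 *
      σ.subst (MvPowerSeries.X 1 : MvPowerSeries (Fin 2) ℚ_[p]) ^ 2 with hRt
  have hL : V.thetaLHS σ = (MvPowerSeries.X 0 : MvPowerSeries (Fin 2) ℚ_[p]) ^ 2 * Lt := by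
    rw [thetaLHS, hLt]; ring
  have hR : V.thetaRHS σ = (MvPowerSeries.X 0 : MvPowerSeries (Fin 2) ℚ_[p]) ^ 2 * Rt := by
    rw [thetaRHS, hRt, hσu]; ring
  rw [hL, hR] at hA ⊢
  -- leading `u`-coefficients
  have hm : -(σ ^ 2 * X ^ 2 : ℚ_[p]⟦X⟧) ≠ 0 := by
    have hσne : σ ≠ 0 := fun h => by
      have := congrArg (coeff 1) h; rw [hσ1, map_zero] at this; exact one_ne_zero this
    exact neg_ne_zero.mpr (mul_ne_zero (pow_ne_zero 2 hσne) (pow_ne_zero 2 PowerSeries.X_ne_zero))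
  have hL0 := subst_zero_X_thetaLTilde (W := V) hodd
  have hR0 := subst_zero_X_thetaRTilde (W := V) σ hs0
  have hdL := subst_zero_X_pderiv_thetaLTilde (W := V) hodd
  have hdR := subst_zero_X_pderiv_thetaRTilde (W := V) σ hs0 hs1
  rw [← hLt] at hL0 hdL
  rw [← hRt] at hR0 hdR
  rw [eq_of_logDeriv₂Num_X_sq_mul_eq hA hm hL0 hR0 hdL hdR]

end Theta

/-! ### Discharge of the named fact -/

/-- **Discharge of `WeierstrassCurve.padicSigma_theta_formal` (θ₂).** For `W/ℚ` globally
minimal, `p ≥ 5` of good ordinary reduction and any Mazur–Tate pair `(σ, c)` of `W ⊗ ℚ_p`, the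
theta relation holds as an identity of formal power series in `ℚ_p⟦u, v⟧`:
`σ(F(u,v)) σ(F(u,i(v))) u²v² = (u²X(v) - v²X(u)) σ(u)² σ(v)²`. (The reduction hypotheses are not
used: the identity holds for every normalised odd solution of the sigma equation of an elliptic
curve with `p`-integral equation, `thetaLHS_eq_thetaRHS`.)
[Blakestad–Grant 2023, Prop. 14; Mazur–Tate 1991, Thm. 3.1; Mazur–Stein–Tate 2006, Thm. 1.3]
[cite: BlakestadGrant2023, Prop. 14] -/
theorem padicSigma_theta_formal_holds : padicSigma_theta_formal := by
  intro W _ _ p _ _ _ _ σ c hpair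
  exact thetaLHS_eq_thetaRHS hpair.constantCoeff_eq hpair.coeff_one_eq hpair.odd hpair.ode

end WeierstrassCurve
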